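import Summits.CriticalPhenomena.SAWScalingLimit.Theses.SAWRestrictionRigidity
import Summits.CriticalPhenomena.SAWScalingLimit.Theorems.SAWRestrictionRigidityRigidityTransportAxioms
import Literature.Probability.RandomPlanarGeometry.ConformalRestrictionHolds
import Literature.Probability.RandomPlanarGeometry.ConformalRestrictionProofs
import Literature.Probability.RandomPlanarGeometry.LatticeSimilarityCovariance
import HarnessLib

/-!
# Direction-preserving covariance forces SLE(8/3) (stub `stub_sleOfDPCovariance`)

Stub B4 of line `registered` (skeleton v6, the mark-fixing cut) for the crux `Rigidity`
(stmt-CriticalPhenomena-1368, routes SAWRestrictionRigidity / SAWZoomRigidity; skeleton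
`Summits/CriticalPhenomena/SAWScalingLimit/Cruxes/Rigidity/Lines/registered.lean`).

Statement. A chordal family `P` (`ChordalFamily.IsChordal`) with the two-sided restriction
property (`ChordalFamily.IsRestriction`), carried by simple boundary-avoiding curves
(`ChordalFamily.IsCarriedBySimpleCurves`), which is covariant under every conformal equivalence
`g : D → D'` of Dobrushin domains (with the marks as boundary values) whose mark pairs are
DIRECTION-PARALLEL, `b' - a' = r (b - a)` with `r > 0`, is in every Dobrushin domain the chordal
SLE(8/3) law.

Proof (rotated families + Lawler–Schramm–Werner 2003, which is PROVED in the tree as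
`LawlerSchrammWerner2003_holds`). Fix the target domain `E` with marks `a_E, b_E` and put
`θ := b_E - a_E ≠ 0`. For every Dobrushin domain `D` with marks `a, b` let
`c_D := θ / (b - a)` and `R_D z := c_D z` (a rotation-dilation about `0`, written
`similarity c_D _ 0`); it depends on `D` only through its two marks. The ROTATED family
`Q D := (R_D⁻¹)_* P (R_D D)` compares laws of `P` only between domains whose chord vector is
EXACTLY `θ`:
* `Q` is chordal, has restriction and is carried by simple curves — transport of structure along
  one plane homeomorphism at a time (`AnchoredPullback.isChordal_step`, `Birth.isRestriction_step`,
  `Birth.simple_step`; for nested domains with the same marks the two rotations coincide);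
* `Q` is conformally covariant under EVERY conformal equivalence: a datum `(D, D', g, Φ)`
  conjugates to `(R_D D, R_{D'} D', R_{D'} ∘ g ∘ R_D⁻¹, R_{D'} ∘ Φ ∘ R_D⁻¹)` (holomorphic:
  `z ↦ c' g (c⁻¹ z)`; boundary values transport along the homeomorphisms), whose two domains have
  chord vector `θ`, hence direction-parallel marks (`r = 1`); the hypothesis applies and is pushed
  forward along `R_{D'}⁻¹` (`Measure.map_map`, functoriality of `CurveClass.map`).
By LSW 2003 (p. 5 result 2) every `Q D` is the chordal SLE(8/3) law; at `D = E`, `c_E = 1`,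
`R_E = id`, so `Q E = P E`.

References: G. F. Lawler, O. Schramm, W. Werner, *Conformal restriction: the chordal case*,
J. Amer. Math. Soc. 16 (2003), p. 5 result 2 [LawlerSchrammWerner2003Restriction]; W. Werner,
*Lectures on two-dimensional critical percolation* (2007), §3.2 (1) (transport of covariance data).
-/

noncomputable section

open Set Filter Topology MeasureTheory
open scoped NNReal
open Literature.Probability.RandomPlanarGeometry
open Summit.CriticalPhenomena.CardyFormulaZ2.Theorems.AnchoredPullback (isChordal_step)
open Summit.CriticalPhenomena.SAWScalingLimit.Cruxes.Rigidity.Birth (isRestriction_step simple_step)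

namespace Summit.CriticalPhenomena.SAWScalingLimit.Cruxes.Rigidity.MarkFixing

/-- Congruence for `similarity` in its coefficient: the proof component is irrelevant, so two
similarities with equal coefficients and translations are equal. [folklore] -/
private theorem similarity_congr {c c' : ℂ} (hc : c ≠ 0) (hc' : c' ≠ 0) (w : ℂ) (h : c = c') :
    similarity c hc w = similarity c' hc' w := by
  subst h
  rfl

/-- The inverse of the linear similarity `z ↦ c z` is `z ↦ c⁻¹ z`. [folklore] -/
private theorem similarity_zero_symm_apply {c : ℂ} (hc : c ≠ 0) (z : ℂ) :
    (similarity c hc 0).symm z = c⁻¹ * z := by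
  rw [Homeomorph.symm_apply_eq, similarity_apply, add_zero, mul_inv_cancel_left₀ hc]

/-- Holomorphy is preserved under conjugation by two linear similarities: if `f` is holomorphic
on `U` then `z ↦ c' f (c⁻¹ z)` is holomorphic on `c U`. [folklore] -/
private theorem differentiableOn_simConj {c c' : ℂ} (hc : c ≠ 0) (hc' : c' ≠ 0) {U : Set ℂ}
    {f : ℂ → ℂ} (hf : DifferentiableOn ℂ f U) :
    DifferentiableOn ℂ (fun z => similarity c' hc' 0 (f ((similarity c hc 0).symm z)))
      (similarity c hc 0 '' U) := by
  rw [Homeomorph.image_eq_preimage_symm]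
  have hfun : (fun z => similarity c' hc' 0 (f ((similarity c hc 0).symm z))) =
      fun z => c' * f (c⁻¹ * z) := by
    funext z
    rw [similarity_apply, similarity_zero_symm_apply, add_zero]
  rw [hfun]
  refine DifferentiableOn.const_mul (hf.comp ?_ ?_) c'
  · fun_prop
  · intro z hz
    rw [mem_preimage, similarity_zero_symm_apply] at hz
    exact hz

/-- **Conjugating a covariance datum by two rotations.** If `P` is covariant under conformal
equivalences with direction-parallel mark pairs, `g : D → D'` is a conformal equivalence with the
marks as boundary values, `Φ` agrees with `g` on `D`, and `a, a' ≠ 0` satisfy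
`a' (b' - a'_0) = a (b - a_0)` (the rotated chords `a D`, `a' D'` have the same chord vector),
then `(a'⁻¹)_* P (a' D') = Φ_* (a⁻¹)_* P (a D)`: the datum conjugates to
`(a D, a' D', a' ∘ g ∘ a⁻¹, a' ∘ Φ ∘ a⁻¹)` with direction-parallel marks (`r = 1`), and the
covariance identity there is pushed forward along `a'⁻¹`. [cite: Werner2007, §3.2 (1)] -/
private theorem covariance_conj {P : ChordalFamily}
    (hcov : ∀ (D D' : DobrushinDomain) (g : ConformalEquiv D.carrier D'.carrier) (Φ : C(ℂ, ℂ)),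
      g.HasBoundaryValue (D.pt 0) (D'.pt 0) → g.HasBoundaryValue (D.pt 1) (D'.pt 1) →
      Set.EqOn Φ g D.carrier →
      (∃ r : ℝ, 0 < r ∧ D'.pt 1 - D'.pt 0 = (r : ℂ) * (D.pt 1 - D.pt 0)) →
      P D' = (P D).map (CurveClass.map Φ))
    {D D' : DobrushinDomain} (g : ConformalEquiv D.carrier D'.carrier) (Φ : C(ℂ, ℂ))
    (h0 : g.HasBoundaryValue (D.pt 0) (D'.pt 0)) (h1 : g.HasBoundaryValue (D.pt 1) (D'.pt 1))
    (hΦg : Set.EqOn Φ g D.carrier) {a a' : ℂ} (ha : a ≠ 0) (ha' : a' ≠ 0)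
    (hpar : a' * (D'.pt 1 - D'.pt 0) = a * (D.pt 1 - D.pt 0)) :
    (P (D'.map (similarity a' ha' 0))).map
        (CurveClass.map ((similarity a' ha' 0).symm : C(ℂ, ℂ))) =
      ((P (D.map (similarity a ha 0))).map
        (CurveClass.map ((similarity a ha 0).symm : C(ℂ, ℂ)))).map (CurveClass.map Φ) := by
  set ψ : ℂ ≃ₜ ℂ := similarity a ha 0 with hψ
  set ψ' : ℂ ≃ₜ ℂ := similarity a' ha' 0 with hψ'
  -- the conjugated conformal equivalence `ψ' ∘ g ∘ ψ⁻¹ : ψ D → ψ' D'`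
  obtain ⟨g', hg'⟩ : ∃ g' : ConformalEquiv (D.map ψ).carrier (D'.map ψ').carrier,
      ∀ z, g' z = ψ' (g (ψ.symm z)) :=
    ⟨{ toFun := fun z => ψ' (g (ψ.symm z))
       invFun := fun z => ψ (g.symm (ψ'.symm z))
       source := ψ '' D.carrier
       target := ψ' '' D'.carrier
       map_source' := by
         rintro _ ⟨x, hx, rfl⟩
         rw [ψ.symm_apply_apply]
         exact mem_image_of_mem ψ' (g.mapsTo hx)
       map_target' := by
         rintro _ ⟨x, hx, rfl⟩
         rw [ψ'.symm_apply_apply]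
         exact mem_image_of_mem ψ (g.symm_mapsTo hx)
       left_inv' := by
         rintro _ ⟨x, hx, rfl⟩
         rw [ψ.symm_apply_apply, ψ'.symm_apply_apply, g.symm_apply_apply hx]
       right_inv' := by
         rintro _ ⟨x, hx, rfl⟩
         rw [ψ'.symm_apply_apply, ψ.symm_apply_apply, g.apply_symm_apply hx]
       source_eq := rfl
       target_eq := rfl
       differentiableOn := by
         rw [hψ, hψ']
         exact differentiableOn_simConj ha ha' g.differentiableOn
       differentiableOn_symm := by
         rw [hψ, hψ']
         exact differentiableOn_simConj ha' ha g.symm.differentiableOn },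
      fun z => rfl⟩
  have hg'fun : (g' : ℂ → ℂ) = ψ' ∘ g ∘ ψ.symm := funext hg'
  -- boundary values transport along the two homeomorphisms
  have hψin : ∀ x : ℂ, Tendsto ψ.symm (𝓝[ψ '' D.carrier] (ψ x)) (𝓝[D.carrier] x) := by
    intro x
    have hc : ContinuousWithinAt ψ.symm (ψ '' D.carrier) (ψ x) :=
      ψ.symm.continuous.continuousWithinAt
    have h := hc.tendsto_nhdsWithin (by
      rintro _ ⟨y, hy, rfl⟩
      rw [ψ.symm_apply_apply]
      exact hy)
    rwa [ψ.symm_apply_apply] at h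
  have hbv : ∀ i : Fin 2, g.HasBoundaryValue (D.pt i) (D'.pt i) →
      g'.HasBoundaryValue ((D.map ψ).pt i) ((D'.map ψ').pt i) := by
    intro i h
    unfold ConformalEquiv.HasBoundaryValue at h ⊢
    rw [hg'fun, MarkedDomain.pt_map, MarkedDomain.pt_map, MarkedDomain.carrier_map]
    exact (ψ'.continuous.tendsto _).comp (h.comp (hψin _))
  -- the conjugated test map `ψ' ∘ Φ ∘ ψ⁻¹`
  set Φ' : C(ℂ, ℂ) := (ψ' : C(ℂ, ℂ)).comp (Φ.comp (ψ.symm : C(ℂ, ℂ))) with hΦ'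
  have hEq : Set.EqOn Φ' g' (D.map ψ).carrier := by
    rintro _ ⟨x, hx, rfl⟩
    rw [hg']
    change ψ' (Φ (ψ.symm (ψ x))) = ψ' (g (ψ.symm (ψ x)))
    rw [ψ.symm_apply_apply, hΦg hx]
  -- the two rotated domains have the same chord vector, hence direction-parallel marks
  have hdir : (D'.map ψ').pt 1 - (D'.map ψ').pt 0 =
      ((1 : ℝ) : ℂ) * ((D.map ψ).pt 1 - (D.map ψ).pt 0) := by
    rw [MarkedDomain.pt_map, MarkedDomain.pt_map, MarkedDomain.pt_map, MarkedDomain.pt_map,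
      Complex.ofReal_one, one_mul, hψ, hψ', similarity_apply, similarity_apply, similarity_apply,
      similarity_apply, add_zero, add_zero, add_zero, add_zero, ← mul_sub, ← mul_sub, hpar]
  -- direction-preserving covariance between the rotated domains, pushed forward along `ψ'⁻¹`
  have key := hcov (D.map ψ) (D'.map ψ') g' Φ' (hbv 0 h0) (hbv 1 h1) hEq ⟨1, one_pos, hdir⟩
  have hΦcomp : (ψ'.symm : C(ℂ, ℂ)).comp Φ' = Φ.comp (ψ.symm : C(ℂ, ℂ)) := by
    ext1 z
    change ψ'.symm (ψ' (Φ (ψ.symm z))) = Φ (ψ.symm z)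
    rw [ψ'.symm_apply_apply]
  rw [key, Measure.map_map (CurveClass.measurable_map _) (CurveClass.measurable_map _),
    Measure.map_map (CurveClass.measurable_map _) (CurveClass.measurable_map _)]
  congr 1
  funext x
  rw [Function.comp_apply, Function.comp_apply, CurveClass.map_map, CurveClass.map_map, hΦcomp]

/-- **The rotated family is chordal SLE(8/3).** For coefficients `c D ≠ 0` depending on `D` only
through its marks and normalising every chord vector to the same `θ` (`c D (b - a) = θ`), the
rotated family `Q D := (c_D⁻¹)_* P (c_D D)` of a chordal, restriction, simple, direction-preserving
covariant family `P` is chordal, conformally covariant, restriction and simple, hence every `Q D`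
is the chordal SLE(8/3) law by Lawler–Schramm–Werner 2003.
[cite: LawlerSchrammWerner2003Restriction, p. 5 result 2] -/
private theorem rotated_isSLELaw {P : ChordalFamily} (hch : P.IsChordal) (hres : P.IsRestriction)
    (hS : P.IsCarriedBySimpleCurves)
    (hcov : ∀ (D D' : DobrushinDomain) (g : ConformalEquiv D.carrier D'.carrier) (Φ : C(ℂ, ℂ)),
      g.HasBoundaryValue (D.pt 0) (D'.pt 0) → g.HasBoundaryValue (D.pt 1) (D'.pt 1) →
      Set.EqOn Φ g D.carrier →
      (∃ r : ℝ, 0 < r ∧ D'.pt 1 - D'.pt 0 = (r : ℂ) * (D.pt 1 - D.pt 0)) →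
      P D' = (P D).map (CurveClass.map Φ))
    (θ : ℂ) (c : DobrushinDomain → ℂ) (hc : ∀ D, c D ≠ 0)
    (hdir : ∀ D : DobrushinDomain, c D * (D.pt 1 - D.pt 0) = θ)
    (hmarks : ∀ D D' : DobrushinDomain, D'.pt 0 = D.pt 0 → D'.pt 1 = D.pt 1 → c D' = c D)
    (E : DobrushinDomain) :
    IsSLELaw ((8 : ℝ≥0) / 3) E ((P (E.map (similarity (c E) (hc E) 0))).map
      (CurveClass.map ((similarity (c E) (hc E) 0).symm : C(ℂ, ℂ)))) := by
  refine LawlerSchrammWerner2003_holds (fun D => (P (D.map (similarity (c D) (hc D) 0))).map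
    (CurveClass.map ((similarity (c D) (hc D) 0).symm : C(ℂ, ℂ)))) ?_ ?_ ?_ ?_ E
  · -- chordal
    intro D
    exact isChordal_step hch _ D
  · -- conformally covariant (every conformal equivalence): both rotated chords equal `θ`
    intro D D' g Φ h0 h1 hΦg
    exact covariance_conj hcov g Φ h0 h1 hΦg (hc D) (hc D') (by rw [hdir, hdir])
  · -- restriction: nested domains with the same marks are rotated by the same map
    intro D D' hsub h0 h1 T hT
    have hcc : similarity (c D') (hc D') 0 = similarity (c D) (hc D) 0 :=
      similarity_congr _ _ _ (hmarks D D' h0 h1)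
    rw [hcc]
    exact isRestriction_step hres _ hsub h0 h1 hT
  · -- carried by simple boundary-avoiding curves
    intro D
    exact simple_step hS _ D

/-- stub B4 (LSW transport, M/L; the new mechanism of v6): a chordal family with restriction and simple boundary-avoiding curves which is covariant under every conformal equivalence with direction-parallel mark pairs is, in EVERY Dobrushin domain, the chordal SLE(8/3) law. Proof: fix the target domain `E` and `θ := b_E - a_E`; for each `D` let `R_D z = c_D z`, `c_D := θ / (b - a)` (a rotation-dilation about `0`, written `similarity c_D _ 0`, depending on `D` only through its two marks); the ROTATED family `Q D := (R_D⁻¹)_* P (R_D D)` is chordal, restriction, simple (`AnchoredPullback.isChordal_step`, `Birth.isRestriction_step`, `Birth.simple_step`, the same `R` for nested pairs with equal marks) and CONFORMALLY COVARIANT: a datum `(D, D', g, Φ)` conjugates to `(R_D D, R_{D'} D', R_{D'} g R_D⁻¹, R_{D'} Φ R_D⁻¹)`, whose two domains have chord vector exactly `θ`, hence direction-parallel marks, so the hypothesis applies; push forward by `R_{D'}⁻¹`. LSW 2003 (`LawlerSchrammWerner2003_holds`, PROVED in the tree) gives `IsSLELaw (8/3) D (Q D)` for all `D`; at `D = E`,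 `c_E = 1`, `R_E = Homeomorph.refl`, so `Q E = P E` (`CurveClass.map_id`, `Measure.map_id`). [cite: LawlerSchrammWerner2003Restriction, p. 5 result 2] -/
theorem stub_sleOfDPCovariance : ∀ P : Literature.Probability.RandomPlanarGeometry.ChordalFamily, P.IsChordal → P.IsRestriction → P.IsCarriedBySimpleCurves → (∀ (D D' : Literature.Probability.RandomPlanarGeometry.DobrushinDomain) (g : Literature.Probability.RandomPlanarGeometry.ConformalEquiv D.carrier D'.carrier) (Φ : C(ℂ, ℂ)), g.HasBoundaryValue (D.pt 0) (D'.pt 0) → g.HasBoundaryValue (D.pt 1) (D'.pt 1) → Set.EqOn Φ g D.carrier → (∃ r : ℝ, 0 < r ∧ D'.pt 1 - D'.pt 0 = (r : ℂ) * (D.pt 1 - D.pt 0)) → P D' = (P D).map (Literature.Probability.RandomPlanarGeometry.CurveClass.map Φ)) → ∀ D : Literature.Probability.RandomPlanarGeometry.DobrushinDomain, Literature.Probability.RandomPlanarGeometry.IsSLELaw ((8 : NNReal) / 3) D (P D) := by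
  intro P hch hres hS hcov E
  -- chord vectors never vanish: the two marks of a Dobrushin domain are distinct
  have hne : ∀ D : DobrushinDomain, D.pt 1 - D.pt 0 ≠ 0 := fun D =>
    sub_ne_zero.2 fun h => absurd (D.pt_injective h) (by decide)
  -- the rotation coefficients `c D := θ / (b - a)`, `θ := b_E - a_E`
  set c : DobrushinDomain → ℂ := fun D => (E.pt 1 - E.pt 0) / (D.pt 1 - D.pt 0) with hc_def
  have hc : ∀ D, c D ≠ 0 := fun D => div_ne_zero (hne E) (hne D)
  have hdir : ∀ D : DobrushinDomain, c D * (D.pt 1 - D.pt 0) = E.pt 1 - E.pt 0 := fun D =>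
    div_mul_cancel₀ _ (hne D)
  have hmarks : ∀ D D' : DobrushinDomain, D'.pt 0 = D.pt 0 → D'.pt 1 = D.pt 1 → c D' = c D := by
    intro D D' h0 h1
    simp only [hc_def, h0, h1]
  have key := rotated_isSLELaw hch hres hS hcov _ c hc hdir hmarks E
  -- at `D = E` the rotation is the identity
  have hcE : c E = 1 := div_self (hne E)
  have hid : similarity (c E) (hc E) 0 = Homeomorph.refl ℂ := by
    rw [similarity_congr (hc E) one_ne_zero 0 hcE]
    exact Homeomorph.ext fun z => by rw [similarity_apply, one_mul, add_zero]; rfl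
  have hrefl : E.map (Homeomorph.refl ℂ) = E :=
    MarkedDomain.ext (JordanDomain.ext (by simp) rfl) rfl
  have hmapid : CurveClass.map ((Homeomorph.refl ℂ).symm : C(ℂ, ℂ)) = id := by
    funext x
    have h : ((Homeomorph.refl ℂ).symm : C(ℂ, ℂ)) = ContinuousMap.id ℂ :=
      ContinuousMap.ext fun z => rfl
    rw [h, CurveClass.map_id, id]
  rw [hid, hrefl, hmapid, Measure.map_id] at key
  exact key

end Summit.CriticalPhenomena.SAWScalingLimit.Cruxes.Rigidity.MarkFixing

end
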